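import Mathlib
import HarnessLib
import Summits.Parity.GeneralizedHardyLittlewood.Theses.PrimeLevelFamEdge
import Literature.NumberTheory.LFunctions.NewformRootNumberPrimeLevel

/-!
# Refutation of `PrimeLevelFamEdge.PeterssonPrinted` (stmt-Parity-20012)

`PeterssonPrinted := KowalskiMichel2000.kowalskiMichel2000_petersson` types Kowalski–Michel 2000,
p. 310 (the display after (16)): `Σʰ_{f ∈ S_2(q)^*} λ_f(m)λ_f(n) = δ(m,n) + O_ε((mn)^{1/2+ε} q^{-3/2})`
at every prime level `q`, but for ALL `m, n ≥ 1`. In print the display is only ever used (and, by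
Petersson's formula with Weil's bound, is only valid) in the range of the mollifier,
`m, n ≤ M² < q`, where `(mn, q) = 1`; the Weil bound carries the factor `(m, n, c)^{1/2}`, which is
`≥ q^{1/2}` on the moduli `c ≡ 0 (q)` as soon as `q ∣ m` and `q ∣ n`. Witness `m = n = q`: for a
newform `f` of prime level `q` and weight `2`, `λ_f(q)² = 1/q` (Atkin–Lehner; tree theorem
`IwaniecSarnak.heckeLambda_level_mul_sqrt_sq`), so `Σʰ λ_f(q)² = q⁻¹ · Σʰ 1` (step `hpet`),
while the typed fact at `m = n = 1` gives `Σʰ 1 = 1 + O(q^{-3/2})`; hence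
`|Σʰ λ_f(q)λ_f(q) − δ(q,q)| = 1 − O(1/q)`, against the claimed `C (q²)^{1/2+ε} q^{-3/2} = C q^{2ε−1/2} → 0`
(take `ε = 1/8` and a prime `q ≥ (4(|C|+1))⁴`). Classification `refuted-misstated`: a missing
side condition `(m, n, q) = 1` that the source keeps implicitly (p. 312, before (23): "since
`(m, q) = 1`"; the mollifier has `m, n ≤ M² < q`). Repaired statement C′ — add ONE binder
`(m.gcd n).Coprime q →` after `1 ≤ n →` in `kowalskiMichel2000_petersson` (equivalently, keep all
`m, n` and multiply the right side by `(((m.gcd n).gcd q : ℕ) : ℝ) ^ (1/2 : ℝ)`): this is Petersson's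
formula with Weil's bound `|S(m,n;c)| ≤ (m,n,c)^{1/2} c^{1/2} τ(c)` and `|J₁(x)| ≤ x/2`, uniformly in
`m, n ≥ 1`. The witness `(q, q)` misses C′, and every consumer in the tree lives inside C′: the total
mass `(1,1)` and the parity identity `(q,1)` (`abs_totalMass_sub_one_le`,
`abs_two_mul_evenMass_sub_totalMass_le`, p477278), the mollifier pair sums `l, m ≤ q̂^{Δ'} < q`
(`mollifierNormBound_of_petersson`, `Δ' < 3/2`), the amplifier pair sums `ℓ, ℓ' < q`
(`pairSum_bounds`). NOT inside C′ as typed: the two re-export lemmas `abs_pairSum_sub_delta_le`,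
`pairSum_bounds` (they restate the unrestricted `∀ l m`) — they need the same binder. C′ in full:
`∀ ε : ℝ, 0 < ε → ∃ C : ℝ, ∀ (q : ℕ) [NeZero q], q.Prime → ∀ m n : ℕ, 1 ≤ m → 1 ≤ n →
  (m.gcd n).Coprime q → ‖pet q m n - (if m = n then 1 else 0)‖ ≤
    C * (((m : ℝ) * n) ^ (1 / 2 + ε)) * (q : ℝ) ^ (-(3 / 2 : ℝ))`. [folklore]

WHAT THIS IS NOT: no claim about the printed estimate (which is correct in its range), about the
family edge, or about Landau–Siegel zeros; it records that ONE typed support input of the route is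
false AS TYPED and names the one-binder repair. «The programme SEARCHES and TYPES; no claim about
Landau–Siegel zeros, Theorems 1–2 of arXiv:2211.02515 or a repaired Margin232 until a kernel theorem
says so.»
-/

namespace Summit.Parity.GeneralizedHardyLittlewood.Theorems

open Literature.NumberTheory.LFunctions
open Literature.NumberTheory.EllipticCurves.ModularForms

/-- Refutes `PrimeLevelFamEdge.PeterssonPrinted` [refuted-misstated]: the typed Kowalski–Michel
Petersson estimate `|Σʰ λ_f(m)λ_f(n) − δ(m,n)| ≤ C_ε (mn)^{1/2+ε} q^{-3/2}` quantifies over ALL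
`m, n ≥ 1`; witness `m = n = q` (prime level, weight 2): `Σʰ λ_f(q)² = q⁻¹ Σʰ 1 = q⁻¹(1 + O(q^{-3/2}))`,
so the left side is `1 − O(1/q)` while the right side is `C q^{2ε−1/2} → 0` (`ε = 1/8`,
`q ≥ (4(|C|+1))⁴` prime). Repaired C′: add the binder `(m.gcd n).Coprime q →` (print, p. 312:
"since `(m, q) = 1`"), or insert the factor `((m,n,q))^{1/2}` on the right; the witness misses C′ and
the tree's consumers instantiate only `(1,1)`, `(q,1)` and indices `< q`. [folklore] -/
theorem PrimeLevelFamEdgePeterssonPrinted_refuted :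
    ¬ Summit.Parity.GeneralizedHardyLittlewood.Theses.PrimeLevelFamEdge.PeterssonPrinted := by
  intro h
  have h' : KowalskiMichel2000.kowalskiMichel2000_petersson := h
  obtain ⟨C, hC⟩ := h' (1 / 8) (by norm_num)
  -- a large prime level
  set K : ℝ := 4 * (|C| + 1) with hK
  have hC0 : 0 ≤ |C| := abs_nonneg C
  have hK1 : 1 ≤ K := by rw [hK]; linarith
  have hKpos : 0 < K := by linarith
  obtain ⟨q, hqge, hq⟩ := Nat.exists_infinite_primes (⌈K ^ 4⌉₊ + 2)
  haveI : NeZero q := ⟨hq.ne_zero⟩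
  -- Atkin–Lehner at the level: `Σʰ λ_f(q)λ_f(q) = q⁻¹ · Σʰ λ_f(1)λ_f(1)` (`λ_f(q)² q = 1`, `λ_f(1) = 1`)
  have hpet : KowalskiMichel2000.pet q q q = ((q : ℂ))⁻¹ * KowalskiMichel2000.pet q 1 1 := by
    unfold KowalskiMichel2000.pet
    rw [← GL2Family.harmonicSum_const_mul]
    unfold GL2Family.harmonicSum
    refine finsum_mem_congr rfl fun f hf ↦ ?_
    have hf' : IsNewform0 f := hf
    have h1 : GL2Family.heckeLambda f 1 = 1 := GL2Family.heckeLambda_one_of_isNormalized hf'.2.2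
    have hsq := IwaniecSarnak.heckeLambda_level_mul_sqrt_sq hq hf'
    have hsqrt : ((Real.sqrt q : ℝ) : ℂ) ^ 2 = (q : ℂ) := by
      rw [← Complex.ofReal_pow, Real.sq_sqrt (Nat.cast_nonneg q), Complex.ofReal_natCast]
    have h2 : GL2Family.heckeLambda f q ^ 2 * (q : ℂ) = 1 := by
      rw [← hsqrt, ← mul_pow]; exact hsq
    have hl : GL2Family.heckeLambda f q * GL2Family.heckeLambda f q = ((q : ℂ))⁻¹ := by
      rw [← sq]; exact eq_inv_of_mul_eq_one_left h2
    simp only [h1, hl, mul_one]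
  have hq1 : (1 : ℝ) ≤ q := by exact_mod_cast hq.one_lt.le
  have hqpos : (0 : ℝ) < q := by linarith
  have hqK4 : K ^ 4 ≤ (q : ℝ) := by
    have : (⌈K ^ 4⌉₊ : ℝ) ≤ q := by exact_mod_cast (by omega : ⌈K ^ 4⌉₊ ≤ q)
    exact (Nat.le_ceil _).trans this
  have hqK : K ≤ (q : ℝ) := by
    calc K = K ^ 1 := (pow_one K).symm
      _ ≤ K ^ 4 := pow_le_pow_right₀ hK1 (by norm_num)
      _ ≤ q := hqK4
  -- the typed fact at (m,n) = (1,1) and at (m,n) = (q,q)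
  have h11 := hC q hq 1 1 le_rfl le_rfl
  rw [if_pos rfl] at h11
  simp only [Nat.cast_one, mul_one, Real.one_rpow] at h11
  have hqq := hC q hq q q hq.one_lt.le hq.one_lt.le
  rw [if_pos rfl] at hqq
  -- exponent bookkeeping: (q·q)^{1/2+1/8} · q^{-3/2} = q^{-1/4} ≤ K⁻¹
  have hXY : ((q : ℝ) * q) ^ ((1 / 2 : ℝ) + 1 / 8) * (q : ℝ) ^ (-(3 / 2 : ℝ)) =
      (q : ℝ) ^ (-(1 / 4 : ℝ)) := by
    rw [Real.mul_rpow hqpos.le hqpos.le, ← Real.rpow_add hqpos, ← Real.rpow_add hqpos]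
    congr 1
    norm_num
  have hq14 : K ≤ (q : ℝ) ^ (1 / 4 : ℝ) := by
    have hmono : (K ^ 4) ^ (1 / 4 : ℝ) ≤ (q : ℝ) ^ (1 / 4 : ℝ) :=
      Real.rpow_le_rpow (by positivity) hqK4 (by norm_num)
    have e : (K ^ 4) ^ (1 / 4 : ℝ) = K := by
      rw [← Real.rpow_natCast, ← Real.rpow_mul hKpos.le]
      norm_num
    rwa [e] at hmono
  have hneg : (q : ℝ) ^ (-(1 / 4 : ℝ)) ≤ K⁻¹ := by
    rw [Real.rpow_neg hqpos.le]
    exact inv_anti₀ hKpos hq14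
  have hq32 : (q : ℝ) ^ (-(3 / 2 : ℝ)) ≤ 1 :=
    Real.rpow_le_one_of_one_le_of_nonpos hq1 (by norm_num)
  -- (A) the harmonic mass is bounded: ‖Σʰ 1‖ ≤ 1 + |C|
  have hA : ‖KowalskiMichel2000.pet q 1 1‖ ≤ 1 + |C| := by
    have h0 := norm_le_insert' (KowalskiMichel2000.pet q 1 1) (1 : ℂ)
    rw [norm_one] at h0
    have : C * (q : ℝ) ^ (-(3 / 2 : ℝ)) ≤ |C| := by
      calc C * (q : ℝ) ^ (-(3 / 2 : ℝ)) ≤ |C| * (q : ℝ) ^ (-(3 / 2 : ℝ)) :=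
            mul_le_mul_of_nonneg_right (le_abs_self C) (by positivity)
        _ ≤ |C| := mul_le_of_le_one_right hC0 hq32
    linarith
  -- (B) the typed error at (q,q) is small: ‖Σʰ λ_f(q)² − 1‖ ≤ |C| K⁻¹
  have hB : ‖KowalskiMichel2000.pet q q q - 1‖ ≤ |C| * K⁻¹ := by
    have e1 : C * (((q : ℝ) * q) ^ ((1 / 2 : ℝ) + 1 / 8)) * (q : ℝ) ^ (-(3 / 2 : ℝ)) =
        C * (q : ℝ) ^ (-(1 / 4 : ℝ)) := by
      rw [mul_assoc, hXY]
    rw [e1] at hqq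
    calc ‖KowalskiMichel2000.pet q q q - 1‖ ≤ C * (q : ℝ) ^ (-(1 / 4 : ℝ)) := hqq
      _ ≤ |C| * (q : ℝ) ^ (-(1 / 4 : ℝ)) :=
          mul_le_mul_of_nonneg_right (le_abs_self C) (by positivity)
      _ ≤ |C| * K⁻¹ := mul_le_mul_of_nonneg_left hneg hC0
  -- (C) but Σʰ λ_f(q)² = q⁻¹ Σʰ 1 is small too
  have hCc : ‖KowalskiMichel2000.pet q q q‖ ≤ (1 + |C|) * K⁻¹ := by
    rw [hpet, norm_mul, norm_inv, Complex.norm_natCast]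
    calc (q : ℝ)⁻¹ * ‖KowalskiMichel2000.pet q 1 1‖ ≤ (q : ℝ)⁻¹ * (1 + |C|) :=
          mul_le_mul_of_nonneg_left hA (by positivity)
      _ ≤ K⁻¹ * (1 + |C|) := mul_le_mul_of_nonneg_right (inv_anti₀ hKpos hqK) (by positivity)
      _ = (1 + |C|) * K⁻¹ := mul_comm _ _
  -- triangle inequality: 1 ≤ ‖pet − 1‖ + ‖pet‖ < 1
  have htri : (1 : ℝ) ≤ ‖KowalskiMichel2000.pet q q q - 1‖ + ‖KowalskiMichel2000.pet q q q‖ := by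
    have h0 := norm_le_insert' (1 : ℂ) (KowalskiMichel2000.pet q q q)
    rw [norm_one, norm_sub_rev] at h0
    linarith
  have hfin : |C| * K⁻¹ + (1 + |C|) * K⁻¹ < 1 := by
    rw [← add_mul, hK, ← div_eq_mul_inv, div_lt_one (by positivity)]
    linarith
  linarith

end Summit.Parity.GeneralizedHardyLittlewood.Theorems
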